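/-
Copyright (c) 2026 the pub-hodgecm-mathlib formalisation cell (harness21).  Prover seat hodgecm-mathlib-A-p12 (g26): line LH4, DYADIC pay-down of `stub_N6ns`
(dealer LH4-plan (g3) words #16/#17 2026-09-02T07:25Z, brick «SPAN-all», CM half at EVERY non-split place); 2026-09-02.
-/
import Literature.NumberTheory.Rogawski1990.UnitaryThreeUnipotentClosedFiltrationCM      -- ★ p849265 (LH3-p02 (g0)): `exists_enum_unipotent_isClosed_iUnion_lt` (hypothesis form); brings ★ p849223 `UnitaryThreeUnipotentStrataCM` (§2 transport at `T = 1`, (S1)(S2) odd)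
import Literature.NumberTheory.Automorphic.UnitaryThreeTransvectionClassOpenOfNorm        -- ★ p850139 (this seat) FILE A: `exists_isOpen_transvection_class_of_norm_lt` (matrix half, norm hypothesis with a RADIUS)
import Literature.NumberTheory.LocalFields.QuadraticNormIndexFiniteCM                     -- ★ p850190 (LH10-p01 (g3)) (W-b): `exists_fixed_norm_eq_of_valued_sub_one_lt_four` (deep σ-fixed one-units are norms, from (W-a) `hsq`)
import Literature.NumberTheory.LocalFields.CompleteValuedSquareRootNearOne                 -- ★ p850199 (LH5-p03 (g2)) (W-a): `exists_mul_self_eq_of_valued_sub_one_lt_four_adicCompletion` (square roots near `1` in `L_w`, any residue characteristic)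
import HarnessLib

/-!
# The unipotent variety of `U(Φ₃)(L⁺_v)` at EVERY non-split place — any residue characteristic, any ramification — modulo the square-root letter (W-a): closed strata,
# each unipotent class open in its stratum, and the closed enumeration of the unipotent classes (Rogawski 1990 §3.9 Prop. 3.9.1; Bernstein–Zelevinsky 1976 §1.5)

Topic `NumberTheory/Rogawski1990`; namespace `Literature.NumberTheory.Rogawski1990`.  THEOREMS ONLY (no definition, no instance, no notation, no named fact, no `sorry`);
kernel lane `--supports stmt-HodgeConjecture-24833`.  Cell `pub/hodgecm-mathlib` (D-0151), crux H413 = `stmt-HodgeConjecture-24833`; line LH4, the DYADIC pay-down leaf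
`Cruxes/H413/Lines/F0_P3c_DyadicPaydown.lean` ED. 1 (LH4-plan (g3) skeleton v1 0447f09394670f4b), organ **(D-SH)** «Shalika at `Φ₃` at dyadic non-split places», brick
**«SPAN-all»** (dealer words #16∕#17): the `hfilt` input of the Howe ∕ Harish-Chandra span property (organ ‹SPAN›) at EVERY non-split place `v` of `L⁺` — odd, unramified
dyadic, and WILD (ramified dyadic) alike — in BINDER form over the square-root letter
(W-a) `hsq : ∀ s : L_w, |s − 1|_w < |4|_w → ∃ r, r·r = s ∧ |r − 1|_w < |2|_w` (strong Hensel ∕ Newton for `X² − s` near `1` in the complete field `L_w`; LH5-p03 (g2) types its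
discharge ★ p850199 `exists_mul_self_eq_of_valued_sub_one_lt_four_adicCompletion`, so §3 gives the BARE twins — hypothesis-free at every non-split place).  Siblings: ★ p849223
(odd, `2 ∈ 𝒪_w^×`), ★ p850186 (unramified, any residue characteristic); §3 of this file supersedes both outright.

THE TEXTS.  (S1′) `isClosed_setOf_sub_one_pow_eq_zero'` = ★ p849223 (S1) :134 with the parity binder `IsUnit (2 : 𝒪[w.1.adicCompletion L]) →` DELETED (it was idle: continuity
only).  (S2′) `exists_isOpen_forall_sameStratum_mem_iff_isConj_of_sqrt` = ★ (S2) :154 with that binder REPLACED IN PLACE by `hsq` (it mentions `w`, so it sits after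
`Subsingleton (PlacesOver L v)` and before `∀ u`).  Corollary `exists_enum_unipotent_isClosed_iUnion_lt_antidiagOne_of_sqrt (L) (v) (w) (hsub) (hsq) (S) (hS)` = ★ p849265 :203 with
`h2 ↦ hsq`, over the parity-free hypothesis form ★ `exists_enum_unipotent_isClosed_iUnion_lt`.

WHY (W-a) IS ALL THAT IS NEEDED (census of ★ p849223, as for ★ p850186).  Order `1` and order `3` of (S2) are residue-characteristic free (`2 ≠ 0` in the characteristic-`0`
field `L_w`, ★ `exists_conj_eq_of_regular_unipotent`).  Order `2` (transvections) needs ONE arithmetic input — «`σ_w`-fixed `a` close enough to `1` is a norm `z·σ_w z`» — which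
★ FILE A `exists_isOpen_transvection_class_of_norm_lt` takes as the hypothesis `hnorm` at a RADIUS `|c|`, `0 < |c| ≤ 1`, shrinking the open set to
`{g | ∃ x, |B₀(x,(g−1)x) − t| < |c·t|}`.  At radius `c := 4`: a `σ_w`-fixed `a` with `|a − 1| < |4|` is `r·r` with `|r − 1| < |2|` by `hsq`, and then `σ_w r = r` by ROOT UNIQUENESS
near `1` (the other root `−r` sits at distance exactly `|2|`; ★ (W-b) `eq_of_mul_self_eq_of_valued_sub_one_lt_two` ∕ `map_eq_self_of_mul_self_eq`), so `a = r·σ_w r` — this is ★ (W-b)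
`exists_fixed_norm_eq_of_valued_sub_one_lt_four (hσv) (hsq)`, cited BY NAME (LH10-p01 (g3) p850190; not restated).  No norm index, no skew uniformiser, no `|2| = 1`.

* §1 **(S1′)** `isClosed_setOf_sub_one_pow_eq_zero'`, **(S2′)** `exists_isOpen_forall_sameStratum_mem_iff_isConj_of_sqrt` (binder form over (W-a));
* §2 **`exists_enum_unipotent_isClosed_iUnion_lt_antidiagOne_of_sqrt`** (the closed enumeration = `hfilt` of ‹SPAN›, every non-split `v`, binder form);
* §3 the BARE twins over ★ p850199: **`exists_isOpen_forall_sameStratum_mem_iff_isConj'`** and **`exists_enum_unipotent_isClosed_iUnion_lt_antidiagOne'`** — EVERY non-split place,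
  no hypothesis on the residue characteristic or the ramification (= ★ p849223 (S2) :154 ∕ ★ p849265 :203 texts with the parity binder DELETED).

HONEST LABEL: HC_CM is proved only modulo the 7 printed citations (2 remaining named inputs: hLiu418 = stmt-HodgeConjecture-24832, h413 = stmt-HodgeConjecture-24833) until
rung 0 closes; this file is in-house point-set topology ∕ linear algebra over a local field, count-neutral (a brick of organ (D-SH)'s in-house road; the dyadic print row
`N6nsDyadicStatement` of the closer moves only if a desk edition consumes the whole road).

## References
* [Rogawski1990] J. D. Rogawski, *Automorphic Representations of Unitary Groups in Three Variables*, Ann. of Math. Stud. 123 (1990), §3.9 p. 32, Prop. 3.9.1 (unipotent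
  classes of `U(3)`: regular class unique; singular classes `[n(t)]`, `t ∈ E⁰∕N E^×`); §8.1 pp. 112–113 (the germ expansion's use of the unipotent classes).
* [BernsteinZelevinsky1976] I. N. Bernstein, A. V. Zelevinsky, *Representations of the group GL(n, F) where F is a non-archimedean local field*, Russian Math. Surveys 31
  (1976), §1.5 (l-spaces: locally closed subsets, stratifications).
* [Serre1979] J.-P. Serre, *Local Fields*, GTM 67 (1979), Ch. II §3 (Hensel ∕ Newton), Ch. V §2 Prop. 3 and §3 (norm groups of quadratic extensions, principal units).
* [PlatonovRapinchuk1994] V. Platonov, A. Rapinchuk, *Algebraic Groups and Number Theory* (1994), §3.1 (topology on `G(K_v)`), §5.1.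
-/

set_option autoImplicit false

noncomputable section

open scoped Valued WithZero Matrix MatrixGroups
open Topology Set NumberField IsDedekindDomain Matrix

namespace Literature.NumberTheory.Rogawski1990

open Literature.NumberTheory.Automorphic Literature.NumberTheory.Automorphic.UnitaryGroup Literature.NumberTheory.GaloisRepresentations
open Literature.NumberTheory.Automorphic.HermitianLattice Literature.NumberTheory.LocalFields

/-! ## §1 The heads (S1′), (S2′) on `G = U(Φ₃)(L⁺_v)` at EVERY non-split place (leaf ED. 1 binder prefix; parity binder deleted ∕ replaced by (W-a) `hsq`) -/

section Heads

/-- **(S1′) CLOSED STRATA** at every non-split place: for every `k`, `{γ ∈ U(Φ₃)(L⁺_v) | (γ − 1)^k = 0}` is closed (the matrix coefficients are continuous on the local carrier).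
= ★ `isClosed_setOf_sub_one_pow_eq_zero` with the idle parity binder `IsUnit (2 : 𝒪[w.1.adicCompletion L]) →` deleted. [cite: Rogawski1990, §3.9 p. 32] [cite: BernsteinZelevinsky1976, §1.5] -/
theorem isClosed_setOf_sub_one_pow_eq_zero' :
    ∀ (L : Type) [Field L] [NumberField L] [IsCMField L] (v : HeightOneSpectrum (𝓞 ↥(maximalRealSubfield L))) (w : UnitaryGroup.PlacesOver L v),
      Subsingleton (UnitaryGroup.PlacesOver L v) →
      ∀ k : ℕ, IsClosed {γ : (cmDatum L 3 (Matrix.of fun i j : Fin 3 => if i.val + j.val + 1 = 3 then (1 : L) else 0)).Local v | ((γ.val : GL (Fin 3) (UnitaryGroup.LocalRing L v)).val - 1) ^ k = 0} := by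
  intro L _ _ _ v w hsub k
  have hw : IsCMField.complexConj L • w.1 = w.1 := smul_placesOver_eq_of_subsingleton L v (IsCMField.complexConj L) hsub w
  have hset : {γ : (cmDatum L 3 (Matrix.of fun i j : Fin 3 => if i.val + j.val + 1 = 3 then (1 : L) else 0)).Local v | ((γ.val : GL (Fin 3) (UnitaryGroup.LocalRing L v)).val - 1) ^ k = 0} =
      (fun y : (cmDatum L 3 (Matrix.of fun i j : Fin 3 => if i.val + j.val + 1 = 3 then (1 : L) else 0)).Local v => ((1 : GL (Fin 3) (w.1.adicCompletion L)) * ((localNonsplitEquiv (IsCMField.complexConj L) (Matrix.of fun i j : Fin 3 => if i.val + j.val + 1 = 3 then (1 : L) else 0) (IsCMField.complexConj_ne_one L) w hw y : ↥(unitaryGroupOfForm (galAdicCompletionMap (L := L) (IsCMField.complexConj L) hw) (placeForm (Matrix.of fun i j : Fin 3 => if i.val + j.val + 1 = 3 then (1 : L) else 0) w.1))) : GL (Fin 3) (w.1.adicCompletion L)) * (1 : GL (Fin 3) (w.1.adicCompletion L))⁻¹)) ⁻¹' {g : GL (Fin 3) (w.1.adicCompletion L) | ((g : Matrix (Fin 3)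 (Fin 3) (w.1.adicCompletion L)) - 1) ^ k = 0} := by
    ext γ
    exact sub_one_pow_eq_zero_iff_conj_localNonsplitEquiv L w hw hsub γ k
  rw [hset]
  exact (isClosed_setOf_coe_sub_one_pow_eq_zero k).preimage (continuous_conj_localNonsplitEquiv_one L w hw)

/-- **(S2′) STRATA-OPEN — EVERY UNIPOTENT CLASS OF `U(Φ₃)(L⁺_v)` IS CUT OUT BY AN OPEN SET INSIDE ITS STRATUM, at EVERY non-split place, modulo the square-root
letter (W-a) `hsq`.**  With `SameStratum u γ :≡ (γ−1)³ = 0 ∧ ((γ−1)² = 0 ↔ (u−1)² = 0) ∧ (γ = 1 ↔ u = 1)` (spelled inline): for every unipotent `u` there is an OPEN `V ⊆ G` with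
`γ ∈ V ↔ IsConj u γ` for all `γ` in the stratum of `u`.  By [Rogawski1990, §3.9 Prop. 3.9.1]: order `3` — `V = univ`, the regular unipotent class is UNIQUE (`2 ≠ 0` in the
characteristic-`0` field `L_w`, ★ `exists_conj_eq_of_regular_unipotent`); order `2` — the transvection classes `[n(t)]` are told apart by the norm class of the invariant
`B₀(x, (γ−1)x) ∈ t·N(L_w)`, LOCALLY CONSTANT at radius `|4|` because a `σ_w`-fixed `a` with `|a − 1| < |4|` is a norm (★ (W-b) `exists_fixed_norm_eq_of_valued_sub_one_lt_four`
from `hsq`, fed to ★ FILE A `exists_isOpen_transvection_class_of_norm_lt (c := 4)`); order `1` — `V = univ`.  = ★ `exists_isOpen_forall_sameStratum_mem_iff_isConj` with the token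
`IsUnit (2 : 𝒪[w.1.adicCompletion L]) →` replaced in place by the binder `hsq`. [cite: Rogawski1990, §3.9 p. 32, Prop. 3.9.1] [cite: Serre1979, Ch. II §3; Ch. V §3]
[cite: BernsteinZelevinsky1976, §1.5] -/
theorem exists_isOpen_forall_sameStratum_mem_iff_isConj_of_sqrt :
    ∀ (L : Type) [Field L] [NumberField L] [IsCMField L] (v : HeightOneSpectrum (𝓞 ↥(maximalRealSubfield L))) (w : UnitaryGroup.PlacesOver L v),
      Subsingleton (UnitaryGroup.PlacesOver L v) →
      (∀ s : w.1.adicCompletion L, Valued.v (s - 1) < Valued.v (4 : w.1.adicCompletion L) →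
        ∃ r : w.1.adicCompletion L, r * r = s ∧ Valued.v (r - 1) < Valued.v (2 : w.1.adicCompletion L)) →
      ∀ u : (cmDatum L 3 (Matrix.of fun i j : Fin 3 => if i.val + j.val + 1 = 3 then (1 : L) else 0)).Local v, ((u.val : GL (Fin 3) (UnitaryGroup.LocalRing L v)).val - 1) ^ 3 = 0 →
        ∃ V : Set ((cmDatum L 3 (Matrix.of fun i j : Fin 3 => if i.val + j.val + 1 = 3 then (1 : L) else 0)).Local v), IsOpen V ∧
          ∀ γ : (cmDatum L 3 (Matrix.of fun i j : Fin 3 => if i.val + j.val + 1 = 3 then (1 : L) else 0)).Local v, (((γ.val : GL (Fin 3) (UnitaryGroup.LocalRing L v)).val - 1) ^ 3 = 0 ∧ (((γ.val : GL (Fin 3) (UnitaryGroup.LocalRing L v)).val - 1) ^ 2 = 0 ↔ ((u.val : GL (Fin 3) (UnitaryGroup.LocalRing L v)).val - 1) ^ 2 = 0) ∧ (γ = 1 ↔ u = 1)) →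
            (γ ∈ V ↔ IsConj u γ) := by
  intro L _ _ _ v w hsub hsq u hu3
  have hw : IsCMField.complexConj L • w.1 = w.1 := smul_placesOver_eq_of_subsingleton L v (IsCMField.complexConj L) hsub w
  haveI : CharZero (w.1.adicCompletion L) := charZero_of_injective_algebraMap (algebraMap L _).injective
  have h2K : (2 : (w.1.adicCompletion L)) ≠ 0 := two_ne_zero
  have hσ : ∀ z : (w.1.adicCompletion L), (galAdicCompletionMap (L := L) (IsCMField.complexConj L) hw) ((galAdicCompletionMap (L := L) (IsCMField.complexConj L) hw) z) = z := galAdicCompletionMap_involutive L v w hw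
  have hvσ : ∀ a : (w.1.adicCompletion L), Valued.v ((galAdicCompletionMap (L := L) (IsCMField.complexConj L) hw) a) = Valued.v a := fun a => by
    simp only [valued_galAdicCompletionMap]
  -- the norm step at radius `|4|`, from (W-a) `hsq` via ★ (W-b): a `σ_w`-fixed `a` with `|a − 1| < |4|` is `r·σ_w r`
  have h4 : (4 : (w.1.adicCompletion L)) ≠ 0 := by norm_num
  have h41 : Valued.v (4 : (w.1.adicCompletion L)) ≤ 1 := by
    have h : ∀ k : ℕ, Valued.v ((k : (w.1.adicCompletion L))) ≤ 1 := fun k => by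
      induction k with
      | zero => simp
      | succ k ih =>
        rw [Nat.cast_succ]
        exact Valuation.map_add_le _ ih (by rw [Valuation.map_one])
    have h' := h 4
    rwa [Nat.cast_ofNat] at h'
  have hnorm : ∀ a : (w.1.adicCompletion L), (galAdicCompletionMap (L := L) (IsCMField.complexConj L) hw) a = a →
      Valued.v (a - 1) < Valued.v (4 : (w.1.adicCompletion L)) → ∃ z : (w.1.adicCompletion L), z ≠ 0 ∧ a = z * (galAdicCompletionMap (L := L) (IsCMField.complexConj L) hw) z := by
    intro a hfix ha
    obtain ⟨r, -, hr⟩ := exists_fixed_norm_eq_of_valued_sub_one_lt_four (galAdicCompletionMap (L := L) (IsCMField.complexConj L) hw) hvσ hsq hfix ha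
    have ha0 : a ≠ 0 := by
      intro h0
      rw [h0, zero_sub, Valuation.map_neg, Valuation.map_one] at ha
      exact lt_irrefl _ (lt_of_lt_of_le ha h41)
    refine ⟨r, fun hr0 => ha0 ?_, hr.symm⟩
    rw [← hr, hr0, zero_mul]
  have hT := placeForm_antidiagOne_eq_formCongr_one L w hw
  -- `ψ(y) ∈ U(σ_w, J₀)`
  have hmem : ∀ y : (cmDatum L 3 (Matrix.of fun i j : Fin 3 => if i.val + j.val + 1 = 3 then (1 : L) else 0)).Local v, ((1 : GL (Fin 3) (w.1.adicCompletion L)) * ((localNonsplitEquiv (IsCMField.complexConj L) (Matrix.of fun i j : Fin 3 => if i.val + j.val + 1 = 3 then (1 : L) else 0) (IsCMField.complexConj_ne_one L) w hw y : ↥(unitaryGroupOfForm (galAdicCompletionMap (L := L) (IsCMField.complexConj L) hw) (placeForm (Matrix.of fun i j : Fin 3 => if i.val + j.val + 1 = 3 then (1 : L) else 0) w.1))) : GL (Fin 3) (w.1.adicCompletion L)) * (1 : GL (Fin 3) (w.1.adicCompletion L))⁻¹) ∈ unitaryGroupOfForm (galAdicCompletionMap (L := L) (IsCMField.complexConj L)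 hw) ((StdForm.antidiagonal 3).over (w.1.adicCompletion L)) := fun y => conj_localNonsplitEquiv_mem L (Matrix.of fun i j : Fin 3 => if i.val + j.val + 1 = 3 then (1 : L) else 0) v w hw hT y
  by_cases hu1 : u = 1
  · -- order 1: the stratum of `1` is `{1}`
    refine ⟨Set.univ, isOpen_univ, fun γ hγ => ⟨fun _ => ?_, fun _ => Set.mem_univ _⟩⟩
    rw [hu1, hγ.2.2.2 hu1]
  by_cases hu2 : ((u.val : GL (Fin 3) (UnitaryGroup.LocalRing L v)).val - 1) ^ 2 = 0
  · -- order 2: transvections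
    have hψ2 : ((((((1 : GL (Fin 3) (w.1.adicCompletion L)) * ((localNonsplitEquiv (IsCMField.complexConj L) (Matrix.of fun i j : Fin 3 => if i.val + j.val + 1 = 3 then (1 : L) else 0) (IsCMField.complexConj_ne_one L) w hw u : ↥(unitaryGroupOfForm (galAdicCompletionMap (L := L) (IsCMField.complexConj L) hw) (placeForm (Matrix.of fun i j : Fin 3 => if i.val + j.val + 1 = 3 then (1 : L) else 0) w.1))) : GL (Fin 3) (w.1.adicCompletion L)) * (1 : GL (Fin 3) (w.1.adicCompletion L))⁻¹) : GL (Fin 3) (w.1.adicCompletion L)) : Matrix (Fin 3) (Fin 3) (w.1.adicCompletion L)) - 1)) * ((((((1 : GL (Fin 3) (w.1.adicCompletion L)) * ((localNonsplitEquiv (IsCMField.complexConj L) (Matrix.of fun i j : Fin 3 => if i.val + j.val + 1 = 3 then (1 : L) else 0) (IsCMField.complexConj_ne_one L) w hw u : ↥(unitaryGroupOfForm (galAdicCompletionMap (L := L) (IsCMField.complexConj L) hw) (placeForm (Matrix.of fun i j : Fin 3 => if i.val + j.val + 1 = 3 then (1 : L) else 0) w.1))) : GL (Fin 3) (w.1.adicCompletion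 L)) * (1 : GL (Fin 3) (w.1.adicCompletion L))⁻¹) : GL (Fin 3) (w.1.adicCompletion L)) : Matrix (Fin 3) (Fin 3) (w.1.adicCompletion L)) - 1)) = 0 := by
      rw [← pow_two]; exact (sub_one_pow_eq_zero_iff_conj_localNonsplitEquiv L w hw hsub u 2).1 hu2
    have hψ1 : ((1 : GL (Fin 3) (w.1.adicCompletion L)) * ((localNonsplitEquiv (IsCMField.complexConj L) (Matrix.of fun i j : Fin 3 => if i.val + j.val + 1 = 3 then (1 : L) else 0) (IsCMField.complexConj_ne_one L) w hw u : ↥(unitaryGroupOfForm (galAdicCompletionMap (L := L) (IsCMField.complexConj L) hw) (placeForm (Matrix.of fun i j : Fin 3 => if i.val + j.val + 1 = 3 then (1 : L) else 0) w.1))) : GL (Fin 3) (w.1.adicCompletion L)) * (1 : GL (Fin 3) (w.1.adicCompletion L))⁻¹) ≠ 1 := fun h => hu1 ((conj_localNonsplitEquiv_eq_one_iff L w hw u).1 h)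
    obtain ⟨V₀, hV₀, hcls, hconv⟩ := exists_isOpen_transvection_class_of_norm_lt (galAdicCompletionMap (L := L) (IsCMField.complexConj L) hw) hσ h4 h41 hnorm (hmem u) hψ2 hψ1
    refine ⟨(fun y : (cmDatum L 3 (Matrix.of fun i j : Fin 3 => if i.val + j.val + 1 = 3 then (1 : L) else 0)).Local v => ((1 : GL (Fin 3) (w.1.adicCompletion L)) * ((localNonsplitEquiv (IsCMField.complexConj L) (Matrix.of fun i j : Fin 3 => if i.val + j.val + 1 = 3 then (1 : L) else 0) (IsCMField.complexConj_ne_one L) w hw y : ↥(unitaryGroupOfForm (galAdicCompletionMap (L := L) (IsCMField.complexConj L) hw) (placeForm (Matrix.of fun i j : Fin 3 => if i.val + j.val + 1 = 3 then (1 : L) else 0) w.1))) : GL (Fin 3) (w.1.adicCompletion L)) * (1 : GL (Fin 3) (w.1.adicCompletion L))⁻¹)) ⁻¹' V₀, hV₀.preimage (continuous_conj_localNonsplitEquiv_one L w hw), fun γ hγ => ?_⟩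
    obtain ⟨hγ3, hγ2, hγ1⟩ := hγ
    have hγ2' : ((γ.val : GL (Fin 3) (UnitaryGroup.LocalRing L v)).val - 1) ^ 2 = 0 := hγ2.2 hu2
    have hγne : γ ≠ 1 := fun h => hu1 (hγ1.1 h)
    constructor
    · intro hV
      have hψγ2 : ((((((1 : GL (Fin 3) (w.1.adicCompletion L)) * ((localNonsplitEquiv (IsCMField.complexConj L) (Matrix.of fun i j : Fin 3 => if i.val + j.val + 1 = 3 then (1 : L) else 0) (IsCMField.complexConj_ne_one L) w hw γ : ↥(unitaryGroupOfForm (galAdicCompletionMap (L := L) (IsCMField.complexConj L) hw) (placeForm (Matrix.of fun i j : Fin 3 => if i.val + j.val + 1 = 3 then (1 : L) else 0) w.1))) : GL (Fin 3) (w.1.adicCompletion L)) * (1 : GL (Fin 3) (w.1.adicCompletion L))⁻¹) : GL (Fin 3) (w.1.adicCompletion L)) : Matrix (Fin 3) (Fin 3) (w.1.adicCompletion L)) - 1)) * ((((((1 : GL (Fin 3) (w.1.adicCompletion L)) * ((localNonsplitEquiv (IsCMField.complexConj L) (Matrix.of fun i j : Fin 3 => if i.val + j.val + 1 = 3 then (1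 : L) else 0) (IsCMField.complexConj_ne_one L) w hw γ : ↥(unitaryGroupOfForm (galAdicCompletionMap (L := L) (IsCMField.complexConj L) hw) (placeForm (Matrix.of fun i j : Fin 3 => if i.val + j.val + 1 = 3 then (1 : L) else 0) w.1))) : GL (Fin 3) (w.1.adicCompletion L)) * (1 : GL (Fin 3) (w.1.adicCompletion L))⁻¹) : GL (Fin 3) (w.1.adicCompletion L)) : Matrix (Fin 3) (Fin 3) (w.1.adicCompletion L)) - 1)) = 0 := by
        rw [← pow_two]; exact (sub_one_pow_eq_zero_iff_conj_localNonsplitEquiv L w hw hsub γ 2).1 hγ2'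
      have hψγ1 : ((1 : GL (Fin 3) (w.1.adicCompletion L)) * ((localNonsplitEquiv (IsCMField.complexConj L) (Matrix.of fun i j : Fin 3 => if i.val + j.val + 1 = 3 then (1 : L) else 0) (IsCMField.complexConj_ne_one L) w hw γ : ↥(unitaryGroupOfForm (galAdicCompletionMap (L := L) (IsCMField.complexConj L) hw) (placeForm (Matrix.of fun i j : Fin 3 => if i.val + j.val + 1 = 3 then (1 : L) else 0) w.1))) : GL (Fin 3) (w.1.adicCompletion L)) * (1 : GL (Fin 3) (w.1.adicCompletion L))⁻¹) ≠ 1 := fun h => hγne ((conj_localNonsplitEquiv_eq_one_iff L w hw γ).1 h)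
      obtain ⟨k, hk, hkc⟩ := hconv _ (hmem γ) hψγ2 hψγ1 hV
      exact (isConj_iff_exists_conj_localNonsplitEquiv L w hw u γ).2 ⟨k, hk, hkc⟩
    · intro hc
      obtain ⟨k, hk, hkc⟩ := (isConj_iff_exists_conj_localNonsplitEquiv L w hw u γ).1 hc
      show ((1 : GL (Fin 3) (w.1.adicCompletion L)) * ((localNonsplitEquiv (IsCMField.complexConj L) (Matrix.of fun i j : Fin 3 => if i.val + j.val + 1 = 3 then (1 : L) else 0) (IsCMField.complexConj_ne_one L) w hw γ : ↥(unitaryGroupOfForm (galAdicCompletionMap (L := L) (IsCMField.complexConj L) hw) (placeForm (Matrix.of fun i j : Fin 3 => if i.val + j.val + 1 = 3 then (1 : L) else 0) w.1))) : GL (Fin 3) (w.1.adicCompletion L)) * (1 : GL (Fin 3) (w.1.adicCompletion L))⁻¹) ∈ V₀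
      rw [← hkc]
      exact hcls k hk
  · -- order 3: regular unipotents form ONE class (`2 ≠ 0` in the field)
    refine ⟨Set.univ, isOpen_univ, fun γ hγ => ⟨fun _ => ?_, fun _ => Set.mem_univ _⟩⟩
    obtain ⟨hγ3, hγ2, -⟩ := hγ
    have hγ2' : ¬ ((γ.val : GL (Fin 3) (UnitaryGroup.LocalRing L v)).val - 1) ^ 2 = 0 := fun h => hu2 (hγ2.1 h)
    have hnil : ∀ y : (cmDatum L 3 (Matrix.of fun i j : Fin 3 => if i.val + j.val + 1 = 3 then (1 : L) else 0)).Local v, ((y.val : GL (Fin 3) (UnitaryGroup.LocalRing L v)).val - 1) ^ 3 = 0 → IsNilpotent (((((1 : GL (Fin 3) (w.1.adicCompletion L)) * ((localNonsplitEquiv (IsCMField.complexConj L) (Matrix.of fun i j : Fin 3 => if i.val + j.val + 1 = 3 then (1 : L) else 0) (IsCMField.complexConj_ne_one L) w hw y : ↥(unitaryGroupOfForm (galAdicCompletionMap (L := L) (IsCMField.complexConj L) hw) (placeForm (Matrix.of fun i j : Fin 3 => if i.val + j.val + 1 = 3 then (1 : L) else 0) w.1))) : GL (Fin 3) (w.1.adicCompletion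 L)) * (1 : GL (Fin 3) (w.1.adicCompletion L))⁻¹) : GL (Fin 3) (w.1.adicCompletion L)) : Matrix (Fin 3) (Fin 3) (w.1.adicCompletion L)) - 1) :=
      fun y hy => ⟨3, (sub_one_pow_eq_zero_iff_conj_localNonsplitEquiv L w hw hsub y 3).1 hy⟩
    have hreg : ∀ y : (cmDatum L 3 (Matrix.of fun i j : Fin 3 => if i.val + j.val + 1 = 3 then (1 : L) else 0)).Local v, ¬ ((y.val : GL (Fin 3) (UnitaryGroup.LocalRing L v)).val - 1) ^ 2 = 0 →
        ((((((1 : GL (Fin 3) (w.1.adicCompletion L)) * ((localNonsplitEquiv (IsCMField.complexConj L) (Matrix.of fun i j : Fin 3 => if i.val + j.val + 1 = 3 then (1 : L) else 0) (IsCMField.complexConj_ne_one L) w hw y : ↥(unitaryGroupOfForm (galAdicCompletionMap (L := L) (IsCMField.complexConj L) hw) (placeForm (Matrix.of fun i j : Fin 3 => if i.val + j.val + 1 = 3 then (1 : L) else 0) w.1))) : GL (Fin 3) (w.1.adicCompletion L)) * (1 : GL (Fin 3) (w.1.adicCompletion L))⁻¹) : GL (Fin 3) (w.1.adicCompletion L))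 : Matrix (Fin 3) (Fin 3) (w.1.adicCompletion L)) - 1)) * ((((((1 : GL (Fin 3) (w.1.adicCompletion L)) * ((localNonsplitEquiv (IsCMField.complexConj L) (Matrix.of fun i j : Fin 3 => if i.val + j.val + 1 = 3 then (1 : L) else 0) (IsCMField.complexConj_ne_one L) w hw y : ↥(unitaryGroupOfForm (galAdicCompletionMap (L := L) (IsCMField.complexConj L) hw) (placeForm (Matrix.of fun i j : Fin 3 => if i.val + j.val + 1 = 3 then (1 : L) else 0) w.1))) : GL (Fin 3) (w.1.adicCompletion L)) * (1 : GL (Fin 3) (w.1.adicCompletion L))⁻¹) : GL (Fin 3) (w.1.adicCompletion L)) : Matrix (Fin 3) (Fin 3) (w.1.adicCompletion L)) - 1)) ≠ 0 :=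
      fun y hy h => hy ((sub_one_pow_eq_zero_iff_conj_localNonsplitEquiv L w hw hsub y 2).2 (by rw [pow_two]; exact h))
    obtain ⟨k, hk, hkc⟩ := exists_conj_eq_of_regular_unipotent (galAdicCompletionMap (L := L) (IsCMField.complexConj L) hw) hσ h2K (hmem u) (hmem γ) (hnil u hu3) (hnil γ hγ3) (hreg u hu2) (hreg γ hγ2')
    exact (isConj_iff_exists_conj_localNonsplitEquiv L w hw u γ).2 ⟨k, hk, hkc⟩

end Heads

/-! ## §2 The closed enumeration of the unipotent classes at EVERY non-split place (`hfilt` of ‹SPAN›), (S1′)(S2′) discharged modulo (W-a) -/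

set_option maxHeartbeats 400000 in
-- statement-heavy carrier (as in ★ `…_antidiagOne_odd`)
/-- **The closed enumeration of the unipotent classes of `U(Φ₃)(L⁺_v)` at EVERY non-split place, modulo the square-root letter (W-a) `hsq`**: (S1′) and (S2′)
discharge the hypotheses of ★ `exists_enum_unipotent_isClosed_iUnion_lt`.  For every finite `S` with `c ∈ S ↔ (γ_c − 1)³ = 0`: `∃ n (e : Fin n → ConjClasses G),
(∀ c, c ∈ S ↔ ∃ i, e i = c) ∧ ∀ k, IsClosed (⋃_{i<k} 𝒪(e i))` — the `hfilt` input of the Howe ∕ Harish-Chandra span property for the unipotent orbital integrals of `U(3)`.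
= ★ `exists_enum_unipotent_isClosed_iUnion_lt_antidiagOne_odd` with `(h2 : IsUnit (2 : 𝒪[w.1.adicCompletion L]))` replaced by `hsq` (after `hsub`).
[cite: Rogawski1990, §3.9 Prop. 3.9.1 p. 32; §8.1 pp. 112–113] [cite: BernsteinZelevinsky1976, §1.5] -/
theorem exists_enum_unipotent_isClosed_iUnion_lt_antidiagOne_of_sqrt (L : Type) [Field L] [NumberField L] [IsCMField L]
    (v : HeightOneSpectrum (𝓞 ↥(maximalRealSubfield L))) (w : UnitaryGroup.PlacesOver L v) (hsub : Subsingleton (UnitaryGroup.PlacesOver L v))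
    (hsq : ∀ s : w.1.adicCompletion L, Valued.v (s - 1) < Valued.v (4 : w.1.adicCompletion L) →
      ∃ r : w.1.adicCompletion L, r * r = s ∧ Valued.v (r - 1) < Valued.v (2 : w.1.adicCompletion L))
    (S : Finset (ConjClasses ((cmDatum L 3 (Matrix.of fun i j : Fin 3 => if i.val + j.val + 1 = 3 then (1 : L) else 0)).Local v)))
    (hS : ∀ c : ConjClasses ((cmDatum L 3 (Matrix.of fun i j : Fin 3 => if i.val + j.val + 1 = 3 then (1 : L) else 0)).Local v), c ∈ S ↔
      (((Quotient.out c : (cmDatum L 3 (Matrix.of fun i j : Fin 3 => if i.val + j.val + 1 = 3 then (1 : L) else 0)).Local v).val : GL (Fin 3) (UnitaryGroup.LocalRing L v)).val - 1) ^ 3 = 0) :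
    ∃ (n : ℕ) (e : Fin n → ConjClasses ((cmDatum L 3 (Matrix.of fun i j : Fin 3 => if i.val + j.val + 1 = 3 then (1 : L) else 0)).Local v)),
      (∀ c, c ∈ S ↔ ∃ i, e i = c) ∧ ∀ k : ℕ, IsClosed (⋃ (i : Fin n) (_ : i.val < k), (e i).carrier) :=
  exists_enum_unipotent_isClosed_iUnion_lt L _ v S hS (isClosed_setOf_sub_one_pow_eq_zero' L v w hsub)
    (exists_isOpen_forall_sameStratum_mem_iff_isConj_of_sqrt L v w hsub hsq)

/-! ## §3 The bare twins: (W-a) discharged by ★ p850199 — EVERY non-split place, hypothesis-free -/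

/-- **(S2) STRATA-OPEN AT EVERY NON-SPLIT PLACE, HYPOTHESIS-FREE**: every unipotent class of `U(Φ₃)(L⁺_v)` is cut out by an open set inside its stratum — any residue
characteristic, any ramification (`hsq` of `exists_isOpen_forall_sameStratum_mem_iff_isConj_of_sqrt` discharged by ★ `exists_mul_self_eq_of_valued_sub_one_lt_four_adicCompletion L w.1`).
= ★ `exists_isOpen_forall_sameStratum_mem_iff_isConj` with the parity binder `IsUnit (2 : 𝒪[w.1.adicCompletion L]) →` DELETED. [cite: Rogawski1990, §3.9 p. 32, Prop. 3.9.1]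
[cite: Serre1979, Ch. II §4 Prop. 7] [cite: BernsteinZelevinsky1976, §1.5] -/
theorem exists_isOpen_forall_sameStratum_mem_iff_isConj' :
    ∀ (L : Type) [Field L] [NumberField L] [IsCMField L] (v : HeightOneSpectrum (𝓞 ↥(maximalRealSubfield L))) (w : UnitaryGroup.PlacesOver L v),
      Subsingleton (UnitaryGroup.PlacesOver L v) →
      ∀ u : (cmDatum L 3 (Matrix.of fun i j : Fin 3 => if i.val + j.val + 1 = 3 then (1 : L) else 0)).Local v, ((u.val : GL (Fin 3) (UnitaryGroup.LocalRing L v)).val - 1) ^ 3 = 0 →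
        ∃ V : Set ((cmDatum L 3 (Matrix.of fun i j : Fin 3 => if i.val + j.val + 1 = 3 then (1 : L) else 0)).Local v), IsOpen V ∧
          ∀ γ : (cmDatum L 3 (Matrix.of fun i j : Fin 3 => if i.val + j.val + 1 = 3 then (1 : L) else 0)).Local v, (((γ.val : GL (Fin 3) (UnitaryGroup.LocalRing L v)).val - 1) ^ 3 = 0 ∧ (((γ.val : GL (Fin 3) (UnitaryGroup.LocalRing L v)).val - 1) ^ 2 = 0 ↔ ((u.val : GL (Fin 3) (UnitaryGroup.LocalRing L v)).val - 1) ^ 2 = 0) ∧ (γ = 1 ↔ u = 1)) →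
            (γ ∈ V ↔ IsConj u γ) :=
  fun L _ _ _ v w hsub => exists_isOpen_forall_sameStratum_mem_iff_isConj_of_sqrt L v w hsub (exists_mul_self_eq_of_valued_sub_one_lt_four_adicCompletion L w.1)

set_option maxHeartbeats 400000 in
-- statement-heavy carrier (as in ★ `…_antidiagOne_odd`)
/-- **The closed enumeration of the unipotent classes of `U(Φ₃)(L⁺_v)` at EVERY non-split place, HYPOTHESIS-FREE** (any residue characteristic, any ramification): for every
finite `S` with `c ∈ S ↔ (γ_c − 1)³ = 0`, `∃ n (e : Fin n → ConjClasses G), (∀ c, c ∈ S ↔ ∃ i, e i = c) ∧ ∀ k, IsClosed (⋃_{i<k} 𝒪(e i))` — the `hfilt` input of the Howe ∕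
Harish-Chandra span property for the unipotent orbital integrals of `U(3)`.  = ★ `exists_enum_unipotent_isClosed_iUnion_lt_antidiagOne_odd` with
`(h2 : IsUnit (2 : 𝒪[w.1.adicCompletion L]))` DELETED. [cite: Rogawski1990, §3.9 Prop. 3.9.1 p. 32; §8.1 pp. 112–113] [cite: BernsteinZelevinsky1976, §1.5] -/
theorem exists_enum_unipotent_isClosed_iUnion_lt_antidiagOne' (L : Type) [Field L] [NumberField L] [IsCMField L]
    (v : HeightOneSpectrum (𝓞 ↥(maximalRealSubfield L))) (w : UnitaryGroup.PlacesOver L v) (hsub : Subsingleton (UnitaryGroup.PlacesOver L v))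
    (S : Finset (ConjClasses ((cmDatum L 3 (Matrix.of fun i j : Fin 3 => if i.val + j.val + 1 = 3 then (1 : L) else 0)).Local v)))
    (hS : ∀ c : ConjClasses ((cmDatum L 3 (Matrix.of fun i j : Fin 3 => if i.val + j.val + 1 = 3 then (1 : L) else 0)).Local v), c ∈ S ↔
      (((Quotient.out c : (cmDatum L 3 (Matrix.of fun i j : Fin 3 => if i.val + j.val + 1 = 3 then (1 : L) else 0)).Local v).val : GL (Fin 3) (UnitaryGroup.LocalRing L v)).val - 1) ^ 3 = 0) :
    ∃ (n : ℕ) (e : Fin n → ConjClasses ((cmDatum L 3 (Matrix.of fun i j : Fin 3 => if i.val + j.val + 1 = 3 then (1 : L) else 0)).Local v)),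
      (∀ c, c ∈ S ↔ ∃ i, e i = c) ∧ ∀ k : ℕ, IsClosed (⋃ (i : Fin n) (_ : i.val < k), (e i).carrier) :=
  exists_enum_unipotent_isClosed_iUnion_lt_antidiagOne_of_sqrt L v w hsub (exists_mul_self_eq_of_valued_sub_one_lt_four_adicCompletion L w.1) S hS

end Literature.NumberTheory.Rogawski1990

end
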